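import Mathlib
import Literature.MathematicalPhysics.QuantumFieldTheory.Balaban1983to89.T3UnitScaleTilt
import Literature.MathematicalPhysics.QuantumFieldTheory.Balaban1983to89.T3UpperLiftSplit
import Literature.MathematicalPhysics.QuantumFieldTheory.Balaban1983to89.T4StabilityFloorUnitary
import Literature.MathematicalPhysics.QuantumFieldTheory.Balaban1983to89.B10Eq71TorusLocal
import Literature.MathematicalPhysics.QuantumFieldTheory.Balaban1983to89.T4PairDerivBridge

/-!
# Route `CoarseStiffnessTail` — CONVEXITY OF THE PRESSURE FOR THE WILSON LAW, and the bare (`j = 0`) plaquette bookkeeping on Bałaban's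
# three-tori (lead's toolkit, seat `ym-line-cst-p1` g12; helper on stmt-QuantumFields-25301; part 1 of 3 of the «mean action» certificate,
# parts 2–3: `…CappedCoarseStiffnessLBareStiffnessOfMeanAction`, `…CappedCoarseStiffnessLMeanAction`)

WHAT IS HERE (all [folklore], definition-free).
§1 Jensen for `exp` on a probability space (`exp_integral_le_integral_exp`, `integral_le_log_integral_exp`: `∫X ≤ log∫e^X` for bounded
   measurable `X`), and for the Wilson–Gibbs law `Gibbs_β = Z(β)⁻¹e^{−βA}dU` of `T4GenFunBounds.gibbsMeasure` (any `RegularGaugeGroup`, any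
   `Params`): `0 ≤ A ≤ 2·#Plaq` (`wilsonAction4_mem`); THE EXPONENTIAL MOMENT OF THE ACTION IS A RATIO OF PARTITION FUNCTIONS,
   `∫e^{tA}dGibbs_β = Z(β − t)/Z(β)` (`integral_exp_mul_action_eq`); CONVEXITY OF THE PRESSURE IN RATIO FORM, `Z(β − t)/Z(β) ≤ exp(t·⟨A⟩_{β−t})`
   for `0 ≤ t ≤ β` (`partitionFn_sub_div_le_exp` — Jensen `∫e^{−tA}dGibbs_{β−t} ≥ e^{−t⟨A⟩_{β−t}}`; the secant of `log Z` on `[β − t, β]` lies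
   below the tangent slope at the left end; no differentiation), hence `∫e^{tA}dGibbs_β ≤ exp(t·⟨A⟩_{β−t})` (`integral_exp_mul_action_le`).
§2 On a `T3Family` (`SU(2)`, finest torus of cut-off `K`, `β_K = (γL^{−K})⁻¹`): `β_K(2γ) = β_K(γ) − β_K(γ)/2`
   (`scheme_β_two_mul`), `Ū^0 = U` (`iter_zero`); `Σ_a|U(∂a) − 1|² ≤ 4A(U)` (tree (11)), `A(U) ≤ ½Σ_a|U(∂a) − 1|²` (tree (0.14)),
   `0 ≤ Σ_a|U(∂a) − 1|² ≤ 4·#Plaq_0`; measurability / integrability bookkeeping; the pointwise splits at the window edge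
   `|W − 1|² ≤ min(|W − 1|², θ²) + 4·1[θ ≤ |W − 1|]` and `|W − 1|² ≤ |W − 1|²·1[|W − 1| < θ] + 4·1[θ ≤ |W − 1|]`.
§3 `ubs_of_uma` — **UNIFORM MEAN ACTION ⇒ UNCAPPED BARE STIFFNESS**: if `β_K·∫Σ_a|U(∂a) − 1|² dGibbs_K ≤ C·#Plaq_0` uniformly (`F.L = L`,
   `γ ≤ γ₁`, all `K`), then `∫exp((1/8)β_K·Σ_a|U(∂a) − 1|²) dGibbs_K ≤ exp((max C 0/2)·#Plaq_0)` for `γ ≤ γ₁/2` — §1 at `t = β_K/2`, where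
   `Gibbs` at `β_K/2` on the cut-off-`K` torus IS `Gibbs_K` at coupling `2γ`, and `A ≤ ½Σ|U(∂a) − 1|²`.
§4 `uma_iff_umwa`: the uniform mean-SQUARE bound `β_K·∫Σ_a|U(∂a) − 1|² dGibbs_K ≤ C·#Plaq_0` (all `F` with `F.L = L`, `γ ≤ γ₁`, `K`) holds iff
   the uniform mean-ACTION bound `β_K·∫A dGibbs_K ≤ C'·#Plaq_0` does (Wilson letters: mean plaquette energy `O(1/β_K)`).

HONEST SCOPE.  Toolkit plus one direction; consumed by parts 2–3, which prove that the `j = 0` face of the crux `CappedCoarseStiffnessL` (and of the registered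
BULK stub) is EQUIVALENT to the uniform mean-action bound.  Nothing of Bałaban's estimates; the crux 25301 and `HistoryTailL` 19936 stay OPEN;
no rung, leaf or summit is proved — `YM3TorusSU2` (R3, RECORD rung, not Clay) is NOT proved; the Yang–Mills mass gap is NOT touched.

References: T. Bałaban, CMP **102** (1985) 255–275 [Balaban1985UV3] ((1)–(3) p.256, (11) p.258); T. Bałaban, CMP **109** (1987) 249–301
[Balaban1987RG1] ((0.11) p.253, (0.14) p.254).
-/

noncomputable section

namespace Summit.QuantumFields.YangMills.Theorems.CoarseStiffnessTailPressureConvexity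

open MeasureTheory ProbabilityTheory Finset
open Literature.MathematicalPhysics.QuantumFieldTheory
open Literature.MathematicalPhysics.QuantumFieldTheory.Balaban1983to89
open Literature.MathematicalPhysics.QuantumFieldTheory.Balaban1983to89.T3ContinuumYM3Torus
open Literature.MathematicalPhysics.QuantumFieldTheory.Balaban1983to89.T3UnitScaleTilt
open Literature.MathematicalPhysics.QuantumFieldTheory.Balaban1983to89.T3UnitLawDensityEML
open Literature.MathematicalPhysics.QuantumFieldTheory.Balaban1983to89.Missing
open Literature.MathematicalPhysics.QuantumFieldTheory.Balaban1983to89.T4StabilityFloorUnitary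
  (one_sub_reTr_le_half_dist1_sq_specialUnitary wilsonAction4_eq_sum)
open Literature.MathematicalPhysics.QuantumFieldTheory.Balaban1983to89.B10Eq71TorusLocal (dist1_sq_le_specialUnitaryGroup)
open Literature.MathematicalPhysics.QuantumFieldTheory.Balaban1983to89.T4PairDerivBridge (dist1_le_two_specialUnitaryGroup)
open Literature.MathematicalPhysics.QuantumFieldTheory.Balaban1983to89.T3UpperLiftSplit (scheme_β_eq)

/-! ## §1 Jensen for `exp`, and the exponential moment of the Wilson action under a Gibbs law -/

section Jensen

variable {Ω : Type*} [MeasurableSpace Ω] {μ : Measure Ω} [IsProbabilityMeasure μ]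

/-- JENSEN FOR THE EXPONENTIAL (bounded measurable `X` on a probability space): `exp(∫X) ≤ ∫exp(X)`. [folklore] -/
theorem exp_integral_le_integral_exp {X : Ω → ℝ} {M : ℝ} (hX : Measurable X) (hb : ∀ ω, |X ω| ≤ M) :
    Real.exp (∫ ω, X ω ∂μ) ≤ ∫ ω, Real.exp (X ω) ∂μ := by
  have hint : Integrable X μ :=
    Integrable.mono' (integrable_const M) hX.aestronglyMeasurable (ae_of_all _ fun ω => by
      rw [Real.norm_eq_abs]; exact hb ω)
  have hint' : Integrable (fun ω => Real.exp (X ω)) μ :=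
    Integrable.mono' (integrable_const (Real.exp M)) hX.exp.aestronglyMeasurable (ae_of_all _ fun ω => by
      rw [Real.norm_eq_abs, abs_of_pos (Real.exp_pos _)]
      exact Real.exp_le_exp.mpr ((le_abs_self _).trans (hb ω)))
  exact convexOn_exp.map_integral_le Real.continuous_exp.continuousOn isClosed_univ
    (ae_of_all _ fun ω => Set.mem_univ _) hint hint'

/-- JENSEN, LOGARITHMIC FORM: `∫X ≤ log ∫exp(X)` (bounded measurable `X`, probability space). [folklore] -/
theorem integral_le_log_integral_exp {X : Ω → ℝ} {M : ℝ} (hX : Measurable X) (hb : ∀ ω, |X ω| ≤ M) :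
    ∫ ω, X ω ∂μ ≤ Real.log (∫ ω, Real.exp (X ω) ∂μ) := by
  have h := exp_integral_le_integral_exp (μ := μ) hX hb
  calc ∫ ω, X ω ∂μ = Real.log (Real.exp (∫ ω, X ω ∂μ)) := (Real.log_exp _).symm
    _ ≤ Real.log (∫ ω, Real.exp (X ω) ∂μ) := Real.log_le_log (Real.exp_pos _) h

end Jensen

section Gibbs

variable {G : Type*} [GaugeGroup G] [MeasurableSpace G] [RegularGaugeGroup G] [HaarData G]

omit [HaarData G] in
/-- `0 ≤ A(U) ≤ 2·#Plaq` for the Wilson action `A(U) = Σ_p (1 − Re tr U(∂p))` (`|Re tr| ≤ 1`). [folklore] -/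
theorem wilsonAction4_mem {P : Params} (U : GaugeField P 0 G) :
    0 ≤ wilsonAction4 U ∧ wilsonAction4 U ≤ 2 * (Fintype.card (Plaq P 0) : ℝ) := by
  rw [wilsonAction4_eq_sum]
  refine ⟨Finset.sum_nonneg fun p _ => sub_nonneg.mpr (GaugeGroup.reTr_le_one _), ?_⟩
  calc ∑ p, (1 - reTr (GaugeField.plaqHol U p)) ≤ ∑ _p : Plaq P 0, (2 : ℝ) :=
        Finset.sum_le_sum fun p _ => by have := RegularGaugeGroup.neg_one_le_reTr (GaugeField.plaqHol U p); linarith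
    _ = 2 * (Fintype.card (Plaq P 0) : ℝ) := by rw [Finset.sum_const, Finset.card_univ, nsmul_eq_mul, mul_comm]

/-- **THE EXPONENTIAL MOMENT OF THE ACTION IS A RATIO OF PARTITION FUNCTIONS**: `∫ e^{tA} dGibbs_β = Z(β − t)/Z(β)` (any real `t`,
`β ≥ 0`; the Gibbs law `Z(β)⁻¹e^{−βA}dU` of `T4GenFunBounds.gibbsMeasure`). [folklore] -/
theorem integral_exp_mul_action_eq (P : Params) {β : ℝ} (hβ : 0 ≤ β) (t : ℝ) :
    ∫ U, Real.exp (t * wilsonAction4 U) ∂T4GenFunBounds.gibbsMeasure (G := G) P β =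
      partitionFn (G := G) P (β - t) / partitionFn (G := G) P β := by
  rw [T4GenFunBounds.integral_gibbsMeasure P hβ]
  unfold partitionFn
  congr 1
  refine integral_congr_ae (ae_of_all _ fun U => ?_)
  simp only [boltzmann, ← Real.exp_add]
  congr 1
  ring

/-- **CONVEXITY OF THE PRESSURE, IN RATIO FORM**: `Z(β − t)/Z(β) ≤ exp(t·⟨A⟩_{β−t})` for `0 ≤ t ≤ β` — because
`Z(β)/Z(β − t) = ∫ e^{−tA} dGibbs_{β−t} ≥ exp(−t⟨A⟩_{β−t})` by Jensen.  (The secant of `log Z` over `[β − t, β]` lies below the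
tangent slope `−⟨A⟩_{β−t}` at the left end; no differentiation is used.) [folklore] -/
theorem partitionFn_sub_div_le_exp (P : Params) {β t : ℝ} (ht : 0 ≤ t) (htβ : t ≤ β) :
    partitionFn (G := G) P (β - t) / partitionFn (G := G) P β ≤
      Real.exp (t * ∫ U, wilsonAction4 U ∂T4GenFunBounds.gibbsMeasure (G := G) P (β - t)) := by
  have hβt : 0 ≤ β - t := sub_nonneg.mpr htβ
  have hβ : 0 ≤ β := ht.trans htβ
  haveI := T4GenFunBounds.isProbabilityMeasure_gibbsMeasure (G := G) P hβt
  have hZ : 0 < partitionFn (G := G) P β := partitionFn_pos' P hβ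
  have hZt : 0 < partitionFn (G := G) P (β - t) := partitionFn_pos' P hβt
  -- `Z(β)/Z(β − t) = ∫ e^{−tA} dGibbs_{β−t}`
  have hid : ∫ U, Real.exp (-t * wilsonAction4 U) ∂T4GenFunBounds.gibbsMeasure (G := G) P (β - t) =
      partitionFn (G := G) P β / partitionFn (G := G) P (β - t) := by
    rw [integral_exp_mul_action_eq P hβt (-t), sub_neg_eq_add, sub_add_cancel]
  -- Jensen
  have hmeas : Measurable fun U : GaugeField P 0 G => -t * wilsonAction4 U :=
    (measurable_wilsonAction4 RegularGaugeGroup.measurable_reTr).const_mul _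
  have hbd : ∀ U : GaugeField P 0 G, |-t * wilsonAction4 U| ≤ |t| * (2 * (Fintype.card (Plaq P 0) : ℝ)) := fun U => by
    obtain ⟨h0, h2⟩ := wilsonAction4_mem U
    rw [abs_mul, abs_neg, abs_of_nonneg h0]
    exact mul_le_mul_of_nonneg_left h2 (abs_nonneg t)
  have hJ := exp_integral_le_integral_exp (μ := T4GenFunBounds.gibbsMeasure (G := G) P (β - t)) hmeas hbd
  rw [hid, integral_const_mul, neg_mul] at hJ
  -- invert
  have hq : 0 < partitionFn (G := G) P (β - t) / partitionFn (G := G) P β := div_pos hZt hZ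
  rw [← inv_le_inv₀ (Real.exp_pos _) hq, ← Real.exp_neg, inv_div]
  exact hJ

/-- **THE EXPONENTIAL MOMENT OF THE ACTION IS CONTROLLED BY THE MEAN ACTION AT THE SHIFTED COUPLING**:
`∫ e^{tA} dGibbs_β ≤ exp(t·⟨A⟩_{β−t})` for `0 ≤ t ≤ β` (§1: ratio of partition functions + convexity of the pressure). [folklore] -/
theorem integral_exp_mul_action_le (P : Params) {β t : ℝ} (ht : 0 ≤ t) (htβ : t ≤ β) :
    ∫ U, Real.exp (t * wilsonAction4 U) ∂T4GenFunBounds.gibbsMeasure (G := G) P β ≤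
      Real.exp (t * ∫ U, wilsonAction4 U ∂T4GenFunBounds.gibbsMeasure (G := G) P (β - t)) := by
  rw [integral_exp_mul_action_eq P (ht.trans htβ) t]
  exact partitionFn_sub_div_le_exp P ht htβ

end Gibbs

/-! ## §2 The bare (`j = 0`) objects on Bałaban's three-tori: pointwise comparisons, measurability, integrability -/

section Bare

variable (F : T3Family)

/-- HALVING THE INVERSE COUPLING IS DOUBLING `γ`: `β_K(2γ) = β_K(γ) − β_K(γ)/2`. [cite: Balaban1985UV3, (1)-(3) p.256] -/
theorem scheme_β_two_mul {γ : ℝ} (hγ : 0 < γ) (K : ℕ) :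
    (F.scheme ℰp (2 * γ)).β K = (γ * ((F.L : ℝ)⁻¹) ^ K)⁻¹ - (γ * ((F.L : ℝ)⁻¹) ^ K)⁻¹ / 2 := by
  rw [scheme_β_eq]
  have hL0 : (0 : ℝ) < F.L := by exact_mod_cast (zero_lt_one.trans F.hL.2)
  have hx : (0 : ℝ) < ((F.L : ℝ)⁻¹) ^ K := pow_pos (inv_pos.mpr hL0) K
  field_simp
  ring

/-- No averaging at height `0`: `Ū^0 = U` (definitional unfolding of `Averaging.iter`, recorded as a rewrite rule). [cite: Balaban1987RG1, (0.11) p.253] -/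
theorem iter_zero {P : Params} {G : Type*} [GaugeGroup G] (av : ∀ j, Averaging P j G) (U : GaugeField P 0 G) :
    Averaging.iter av 0 U = U := rfl

/-- `Σ_a |U(∂a) − 1|² ≤ 4·A(U)` on `SU(2)` (tree (11): `|W − 1|² ≤ 2N(1 − Re tr W)`, `N = 2`). [cite: Balaban1985UV3, (11) p.258] -/
theorem sqSum_le_four_mul_action {K : ℕ} (U : GaugeField (F.P K) 0 (Matrix.specialUnitaryGroup (Fin 2) ℂ)) :
    ∑ a : Plaq (F.P K) 0, dist1 (GaugeField.plaqHol U a) ^ 2 ≤ 4 * wilsonAction4 U := by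
  rw [wilsonAction4_eq_sum, Finset.mul_sum]
  refine Finset.sum_le_sum fun a _ => ?_
  have h := dist1_sq_le_specialUnitaryGroup (N := 2) (GaugeField.plaqHol U a)
  calc dist1 (GaugeField.plaqHol U a) ^ 2 ≤ 2 * (((2 : ℕ) : ℝ) * (1 - reTr (GaugeField.plaqHol U a))) := h
    _ = 4 * (1 - reTr (GaugeField.plaqHol U a)) := by push_cast; ring

/-- `A(U) ≤ ½·Σ_a |U(∂a) − 1|²` on `SU(2)` ([Balaban1987RG1] (0.14): `2[1 − Re tr U] ≤ |U − 1|²`). [cite: Balaban1987RG1, (0.14) p.254] -/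
theorem action_le_half_sqSum {K : ℕ} (U : GaugeField (F.P K) 0 (Matrix.specialUnitaryGroup (Fin 2) ℂ)) :
    wilsonAction4 U ≤ 1 / 2 * ∑ a : Plaq (F.P K) 0, dist1 (GaugeField.plaqHol U a) ^ 2 := by
  rw [wilsonAction4_eq_sum, Finset.mul_sum]
  exact Finset.sum_le_sum fun a _ => one_sub_reTr_le_half_dist1_sq_specialUnitary (N := 2) (GaugeField.plaqHol U a)

/-- `0 ≤ Σ_a |U(∂a) − 1|² ≤ 4·#Plaq` (`|W − 1| ≤ 2` on `SU(2)`). [folklore] -/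
theorem sqSum_mem {K : ℕ} (U : GaugeField (F.P K) 0 (Matrix.specialUnitaryGroup (Fin 2) ℂ)) :
    0 ≤ ∑ a : Plaq (F.P K) 0, dist1 (GaugeField.plaqHol U a) ^ 2 ∧
      ∑ a : Plaq (F.P K) 0, dist1 (GaugeField.plaqHol U a) ^ 2 ≤ 4 * (Fintype.card (Plaq (F.P K) 0) : ℝ) := by
  refine ⟨Finset.sum_nonneg fun a _ => sq_nonneg _, ?_⟩
  calc ∑ a : Plaq (F.P K) 0, dist1 (GaugeField.plaqHol U a) ^ 2 ≤ ∑ _a : Plaq (F.P K) 0, (4 : ℝ) :=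
        Finset.sum_le_sum fun a _ => by
          have h2 := dist1_le_two_specialUnitaryGroup (GaugeField.plaqHol U a)
          have h0 := GaugeGroup.dist1_nonneg (GaugeField.plaqHol U a)
          nlinarith
    _ = 4 * (Fintype.card (Plaq (F.P K) 0) : ℝ) := by rw [Finset.sum_const, Finset.card_univ, nsmul_eq_mul, mul_comm]

/-- Measurability of `U ↦ |U(∂a) − 1|`. [folklore] -/
theorem measurable_dist1_plaqHol (K : ℕ) (a : Plaq (F.P K) 0) :
    Measurable fun U : GaugeField (F.P K) 0 (Matrix.specialUnitaryGroup (Fin 2) ℂ) => dist1 (GaugeField.plaqHol U a) :=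
  RegularGaugeGroup.measurable_dist1.comp (measurable_plaqHol a)

/-- Measurability of `U ↦ Σ_a |U(∂a) − 1|²`. [folklore] -/
theorem measurable_sqSum (K : ℕ) :
    Measurable fun U : GaugeField (F.P K) 0 (Matrix.specialUnitaryGroup (Fin 2) ℂ) =>
      ∑ a : Plaq (F.P K) 0, dist1 (GaugeField.plaqHol U a) ^ 2 :=
  Finset.measurable_sum _ fun a _ => (measurable_dist1_plaqHol F K a).pow_const 2

/-- A bounded measurable function is integrable against a finite measure. [folklore] -/
theorem integrable_of_bounded {Ω : Type*} [MeasurableSpace Ω] {μ : Measure Ω} [IsFiniteMeasure μ] {f : Ω → ℝ} {M : ℝ}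
    (hf : Measurable f) (hM : ∀ ω, |f ω| ≤ M) : Integrable f μ :=
  Integrable.mono' (integrable_const M) hf.aestronglyMeasurable (ae_of_all _ fun ω => by rw [Real.norm_eq_abs]; exact hM ω)

/-- **THE BARE DECOMPOSITION BELOW/ABOVE THE WINDOW EDGE** (pointwise, `SU(2)`): `|W − 1|² ≤ min(|W − 1|², θ²) + 4·1[θ ≤ |W − 1|]`. [folklore] -/
theorem sq_le_capped_add_edge (W : Matrix.specialUnitaryGroup (Fin 2) ℂ) (θ : ℝ) :
    dist1 W ^ 2 ≤ min (dist1 W ^ 2) (θ ^ 2) + (if θ ≤ dist1 W then (4 : ℝ) else 0) := by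
  have h0 := GaugeGroup.dist1_nonneg W
  have h2 := dist1_le_two_specialUnitaryGroup W
  by_cases h : θ ≤ dist1 W
  · rw [if_pos h]
    have hmin : 0 ≤ min (dist1 W ^ 2) (θ ^ 2) := le_min (sq_nonneg _) (sq_nonneg _)
    nlinarith
  · rw [if_neg h, add_zero, min_eq_left (pow_le_pow_left₀ h0 (lt_of_not_ge h).le 2)]

/-- The same with the sub-threshold (bulk) square: `|W − 1|² ≤ |W − 1|²·1[|W − 1| < θ] + 4·1[θ ≤ |W − 1|]`. [folklore] -/
theorem sq_le_bulk_add_edge (W : Matrix.specialUnitaryGroup (Fin 2) ℂ) (θ : ℝ) :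
    dist1 W ^ 2 ≤ (if dist1 W < θ then dist1 W ^ 2 else 0) + (if θ ≤ dist1 W then (4 : ℝ) else 0) := by
  have h0 := GaugeGroup.dist1_nonneg W
  have h2 := dist1_le_two_specialUnitaryGroup W
  by_cases h : θ ≤ dist1 W
  · rw [if_pos h, if_neg (not_lt.mpr h)]
    nlinarith
  · rw [if_neg h, if_pos (lt_of_not_ge h), add_zero]

end Bare

/-! ## §3 UNIFORM MEAN ACTION ⇒ UNCAPPED BARE STIFFNESS (convexity of the pressure) -/

section MeanToStiffness

/-- **UNIFORM MEAN ACTION ⇒ UNCAPPED BARE STIFFNESS.**  If the mean of `β_K·Σ_a |U(∂a) − 1|²` under `Gibbs_K` is `≤ C·#Plaq_0` uniformly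
(`F.L = L`, `0 < γ ≤ γ₁`, all `K`), then for `γ ≤ γ₁/2` the UNCAPPED bare stiffness has free energy `O(1)` per plaquette:
`∫ exp((1/8)·β_K·Σ_a|U(∂a) − 1|²) dGibbs_K ≤ exp((max C 0/2)·#Plaq_0)`.  Proof: `Σ|U(∂a) − 1|² ≤ 4A(U)`, `∫e^{(β/2)A}dGibbs_β ≤
exp((β/2)·⟨A⟩_{β/2})` (§1), `⟨A⟩_{β/2}` is the mean action of the SAME lattice at coupling `2γ`, and `A ≤ ½Σ|U(∂a) − 1|²`. [folklore] -/
theorem ubs_of_uma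
    (h : ∀ (L : ℕ), ∃ (C γ₁ : ℝ), 0 < γ₁ ∧ γ₁ ≤ 1 ∧ ∀ (F : T3Family) (γ : ℝ), F.L = L → 0 < γ → γ ≤ γ₁ → ∀ (K : ℕ),
      (γ * ((F.L : ℝ)⁻¹) ^ K)⁻¹ * ∫ U, (∑ a : Plaq (F.P K) 0, dist1 (GaugeField.plaqHol U a) ^ 2) ∂(gibbsK F ℰp γ K) ≤
        C * (Fintype.card (Plaq (F.P K) 0) : ℝ)) :
    ∀ (L : ℕ), ∃ (c₀ C₀ γ₁ : ℝ), 0 < c₀ ∧ 0 < γ₁ ∧ γ₁ ≤ 1 ∧ ∀ (F : T3Family) (γ : ℝ), F.L = L → 0 < γ → γ ≤ γ₁ → ∀ (K : ℕ),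
      ∫ U, Real.exp (c₀ * (γ * ((F.L : ℝ)⁻¹) ^ K)⁻¹ * ∑ a : Plaq (F.P K) 0, dist1 (GaugeField.plaqHol U a) ^ 2)
          ∂(gibbsK F ℰp γ K) ≤ Real.exp (C₀ * (Fintype.card (Plaq (F.P K) 0) : ℝ)) := by
  intro L
  obtain ⟨C, γ₁, hγ₁, hγ₁1, hC⟩ := h L
  refine ⟨1 / 8, max C 0 / 2, γ₁ / 2, by norm_num, by positivity, by linarith, fun F γ hL hγ hγle K => ?_⟩
  have h2γ : 2 * γ ≤ γ₁ := by linarith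
  have h2γ0 : 0 < 2 * γ := by linarith
  set β : ℝ := (γ * ((F.L : ℝ)⁻¹) ^ K)⁻¹ with hβdef
  set n : ℝ := (Fintype.card (Plaq (F.P K) 0) : ℝ) with hndef
  have hβ0 : 0 < β := inv_pos.mpr (mul_pos hγ (pow_pos (inv_pos.mpr (by exact_mod_cast (zero_lt_one.trans F.hL.2))) K))
  haveI := isProbabilityMeasure_gibbsK F ℰp hγ.le K
  -- Step 1: pointwise, `exp((1/8)βΣd²) ≤ exp((β/2)·A)`
  have hpt : ∀ U : GaugeField (F.P K) 0 (Matrix.specialUnitaryGroup (Fin 2) ℂ),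
      Real.exp (1 / 8 * β * ∑ a : Plaq (F.P K) 0, dist1 (GaugeField.plaqHol U a) ^ 2) ≤
        Real.exp (β / 2 * wilsonAction4 U) := fun U => by
    refine Real.exp_le_exp.mpr ?_
    have := sqSum_le_four_mul_action F U
    nlinarith
  -- Step 2: integrate; `∫ exp((β/2)A) dGibbs_β ≤ exp((β/2)·⟨A⟩_{β/2})`
  have hint : Integrable (fun U : GaugeField (F.P K) 0 (Matrix.specialUnitaryGroup (Fin 2) ℂ) =>
      Real.exp (β / 2 * wilsonAction4 U)) (gibbsK F ℰp γ K) := by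
    refine integrable_of_bounded ((measurable_wilsonAction4 RegularGaugeGroup.measurable_reTr).const_mul _).exp
      (M := Real.exp (β / 2 * (2 * n))) fun U => ?_
    rw [abs_of_pos (Real.exp_pos _)]
    obtain ⟨h0, h2⟩ := wilsonAction4_mem U
    exact Real.exp_le_exp.mpr (mul_le_mul_of_nonneg_left h2 (by positivity))
  have hstep2 : ∫ U, Real.exp (1 / 8 * β * ∑ a : Plaq (F.P K) 0, dist1 (GaugeField.plaqHol U a) ^ 2) ∂(gibbsK F ℰp γ K) ≤
      Real.exp (β / 2 * ∫ U, wilsonAction4 U ∂(T4GenFunBounds.gibbsMeasure (G := Matrix.specialUnitaryGroup (Fin 2) ℂ) (F.P K) (β - β / 2))) := by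
    calc ∫ U, Real.exp (1 / 8 * β * ∑ a : Plaq (F.P K) 0, dist1 (GaugeField.plaqHol U a) ^ 2) ∂(gibbsK F ℰp γ K)
        ≤ ∫ U, Real.exp (β / 2 * wilsonAction4 U) ∂(gibbsK F ℰp γ K) :=
          integral_mono_of_nonneg (ae_of_all _ fun U => (Real.exp_pos _).le) hint (ae_of_all _ hpt)
      _ ≤ Real.exp (β / 2 * ∫ U, wilsonAction4 U ∂(T4GenFunBounds.gibbsMeasure (G := Matrix.specialUnitaryGroup (Fin 2) ℂ) (F.P K) (β - β / 2))) := by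
          rw [gibbsK_eq, scheme_β_eq]
          exact integral_exp_mul_action_le (F.P K) (by positivity) (by linarith)
  -- Step 3: the shifted law is `Gibbs_K` at coupling `2γ`; its mean action is `≤ ½·(mean Σd²) ≤ C n/β`
  have hlaw : T4GenFunBounds.gibbsMeasure (G := Matrix.specialUnitaryGroup (Fin 2) ℂ) (F.P K) (β - β / 2) =
      gibbsK F ℰp (2 * γ) K := by
    rw [gibbsK_eq, scheme_β_two_mul F hγ K]
  haveI := isProbabilityMeasure_gibbsK F ℰp h2γ0.le K
  have hmeanC := hC F (2 * γ) hL h2γ0 h2γ K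
  have hβ2 : (2 * γ * ((F.L : ℝ)⁻¹) ^ K)⁻¹ = β / 2 := by
    have : (2 * γ * ((F.L : ℝ)⁻¹) ^ K)⁻¹ = (F.scheme ℰp (2 * γ)).β K := (scheme_β_eq F (2 * γ) K).symm
    rw [this, scheme_β_two_mul F hγ K]
    ring
  rw [hβ2] at hmeanC
  have hA : ∫ U, wilsonAction4 U ∂(gibbsK F ℰp (2 * γ) K) ≤
      1 / 2 * ∫ U, (∑ a : Plaq (F.P K) 0, dist1 (GaugeField.plaqHol U a) ^ 2) ∂(gibbsK F ℰp (2 * γ) K) := by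
    rw [← integral_const_mul]
    refine integral_mono_of_nonneg (ae_of_all _ fun U => (wilsonAction4_mem U).1) ?_
      (ae_of_all _ fun U => action_le_half_sqSum F U)
    refine integrable_of_bounded ((measurable_sqSum F K).const_mul _) (M := 1 / 2 * (4 * n)) fun U => ?_
    obtain ⟨h0, h4⟩ := sqSum_mem F U
    rw [abs_of_nonneg (by positivity)]
    exact mul_le_mul_of_nonneg_left h4 (by norm_num)
  refine hstep2.trans (Real.exp_le_exp.mpr ?_)
  rw [hlaw]
  have hn : 0 ≤ n := Nat.cast_nonneg _
  calc β / 2 * ∫ U, wilsonAction4 U ∂(gibbsK F ℰp (2 * γ) K)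
      ≤ β / 2 * (1 / 2 * ∫ U, (∑ a : Plaq (F.P K) 0, dist1 (GaugeField.plaqHol U a) ^ 2) ∂(gibbsK F ℰp (2 * γ) K)) :=
        mul_le_mul_of_nonneg_left hA (by positivity)
    _ = 1 / 2 * (β / 2 * ∫ U, (∑ a : Plaq (F.P K) 0, dist1 (GaugeField.plaqHol U a) ^ 2) ∂(gibbsK F ℰp (2 * γ) K)) := by ring
    _ ≤ 1 / 2 * (C * n) := mul_le_mul_of_nonneg_left hmeanC (by norm_num)
    _ ≤ max C 0 / 2 * n := by nlinarith [le_max_left C 0, le_max_right C 0]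

end MeanToStiffness

/-! ## §4 Mean square versus mean action (the two classical currencies) -/

section Currencies

/-- **UNIFORM MEAN ACTION ⇔ UNIFORM MEAN WILSON ACTION** (`A ≤ ½Σ|U(∂a) − 1|² ≤ 2A` on `SU(2)`): the classical letters —
`β_K·⟨A⟩_{Gibbs_K} ≤ C·#Plaq_0`, i.e. mean plaquette energy `O(1/β_K)` uniformly in the volume, the cut-off and `γ ≤ γ₁`.
[cite: Balaban1985UV3, (11) p.258; Balaban1987RG1, (0.14) p.254] -/
theorem uma_iff_umwa :
    (∀ (L : ℕ), ∃ (C γ₁ : ℝ), 0 < γ₁ ∧ γ₁ ≤ 1 ∧ ∀ (F : T3Family) (γ : ℝ), F.L = L → 0 < γ → γ ≤ γ₁ → ∀ (K : ℕ),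
      (γ * ((F.L : ℝ)⁻¹) ^ K)⁻¹ * ∫ U, (∑ a : Plaq (F.P K) 0, dist1 (GaugeField.plaqHol U a) ^ 2) ∂(gibbsK F ℰp γ K) ≤
        C * (Fintype.card (Plaq (F.P K) 0) : ℝ)) ↔
    (∀ (L : ℕ), ∃ (C γ₁ : ℝ), 0 < γ₁ ∧ γ₁ ≤ 1 ∧ ∀ (F : T3Family) (γ : ℝ), F.L = L → 0 < γ → γ ≤ γ₁ → ∀ (K : ℕ),
      (γ * ((F.L : ℝ)⁻¹) ^ K)⁻¹ * ∫ U, wilsonAction4 U ∂(gibbsK F ℰp γ K) ≤ C * (Fintype.card (Plaq (F.P K) 0) : ℝ)) := by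
  constructor
  · intro h L
    obtain ⟨C, γ₁, hγ₁, hγ₁1, hC⟩ := h L
    refine ⟨C / 2, γ₁, hγ₁, hγ₁1, fun F γ hL hγ hγle K => ?_⟩
    have hβ0 : 0 < (γ * ((F.L : ℝ)⁻¹) ^ K)⁻¹ :=
      inv_pos.mpr (mul_pos hγ (pow_pos (inv_pos.mpr (by exact_mod_cast (zero_lt_one.trans F.hL.2))) K))
    haveI := isProbabilityMeasure_gibbsK F ℰp hγ.le K
    have hA : ∫ U, wilsonAction4 U ∂(gibbsK F ℰp γ K) ≤
        1 / 2 * ∫ U, (∑ a : Plaq (F.P K) 0, dist1 (GaugeField.plaqHol U a) ^ 2) ∂(gibbsK F ℰp γ K) := by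
      rw [← integral_const_mul]
      refine integral_mono_of_nonneg (ae_of_all _ fun U => (wilsonAction4_mem U).1) ?_
        (ae_of_all _ fun U => action_le_half_sqSum F U)
      refine integrable_of_bounded ((measurable_sqSum F K).const_mul _) (M := 1 / 2 * (4 * (Fintype.card (Plaq (F.P K) 0) : ℝ)))
        fun U => ?_
      obtain ⟨h0, h4⟩ := sqSum_mem F U
      rw [abs_of_nonneg (by positivity)]
      exact mul_le_mul_of_nonneg_left h4 (by norm_num)
    have := hC F γ hL hγ hγle K
    nlinarith [mul_le_mul_of_nonneg_left hA hβ0.le]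
  · intro h L
    obtain ⟨C, γ₁, hγ₁, hγ₁1, hC⟩ := h L
    refine ⟨4 * C, γ₁, hγ₁, hγ₁1, fun F γ hL hγ hγle K => ?_⟩
    have hβ0 : 0 < (γ * ((F.L : ℝ)⁻¹) ^ K)⁻¹ :=
      inv_pos.mpr (mul_pos hγ (pow_pos (inv_pos.mpr (by exact_mod_cast (zero_lt_one.trans F.hL.2))) K))
    haveI := isProbabilityMeasure_gibbsK F ℰp hγ.le K
    have hA : ∫ U, (∑ a : Plaq (F.P K) 0, dist1 (GaugeField.plaqHol U a) ^ 2) ∂(gibbsK F ℰp γ K) ≤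
        4 * ∫ U, wilsonAction4 U ∂(gibbsK F ℰp γ K) := by
      rw [← integral_const_mul]
      refine integral_mono_of_nonneg (ae_of_all _ fun U => (sqSum_mem F U).1) ?_
        (ae_of_all _ fun U => sqSum_le_four_mul_action F U)
      refine integrable_of_bounded ((measurable_wilsonAction4 RegularGaugeGroup.measurable_reTr).const_mul _)
        (M := 4 * (2 * (Fintype.card (Plaq (F.P K) 0) : ℝ))) fun U => ?_
      obtain ⟨h0, h2⟩ := wilsonAction4_mem U
      rw [abs_of_nonneg (by positivity)]
      exact mul_le_mul_of_nonneg_left h2 (by norm_num)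
    have := hC F γ hL hγ hγle K
    nlinarith [mul_le_mul_of_nonneg_left hA hβ0.le]

end Currencies

end Summit.QuantumFields.YangMills.Theorems.CoarseStiffnessTailPressureConvexity

end
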